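import Mathlib.Algebra.Order.BigOperators.Group.Finset
import Mathlib.Algebra.BigOperators.Ring.Finset
import Mathlib.Data.Real.Basic
import Mathlib.Data.Finset.Powerset
import Mathlib.Tactic.Linarith
import Mathlib.Tactic.Ring
import HarnessLib

/-!
# Flip-symmetric blocks: twisted positive association gives the T-sum, and the `K ∪ B`-fibre reduction of `A₀₀` — prim-lf-2 gen 61

Support file (`--supports stmt-CriticalPhenomena-4575`, closed), prover `prim-lf-2` (gen 61).  No definitions, no named facts, no sorries; standard axioms.
Memo `prim-lf-2/CW-FIBRE-gen61.md` (the M-FIBRE CONJECTURE) and `CW-ATOM-gen60.md` §9 (NC-SPLIT `NC = A₀₀ + 2·A₀B`, `…NoCoreAtomSplit.lean`).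

SETTING (as in `…NoCoreAtomSplit.lean`).  `E : Finset ι` is the edge set, a colouring is its red set `s ⊆ E`, `K : Finset ι → Set V` is any map (the red cluster
of the root as a function of the red set; the blue cluster is then `K (E ∖ s)`), and `T(X,Y) = (fX − fY)(gX − gY)` for monotone `f, g : Set V → ℝ`.
A finset `F` of colourings is FLIP-INVARIANT if `s ∈ F → E ∖ s ∈ F`, and TWISTED POSITIVELY ASSOCIATED if for all `Φ, Ψ : Finset ι → ℝ` that are monotone on `F`
for the twisted preorder (`K s ⊆ K t` and `K (E∖t) ⊆ K (E∖s)`) one has `(Σ_F Φ)(Σ_F Ψ) ≤ |F| · Σ_F Φ Ψ` (uniform measure on `F`).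

* `Coefficientwise.flipBlock_tsum_nonneg` — on a flip-invariant, twisted positively associated block `F ⊆ 𝒫(E)`:  `0 ≤ Σ_{s∈F} T(K s, K(E∖s))`.
  (Harris-type expansion of the four products + `Σ_F f(K s) = Σ_F f(K(E∖s))` by the flip.)
* `Coefficientwise.twoSidedAvoidance_tsum_nonneg_of_fibrePA` — if EVERY fibre `{s ⊆ E : K s ∪ K(E∖s) = M}` of the flip-invariant set `M = K ∪ B` is twisted
  positively associated, then for every vertex set `X`:  `0 ≤ Σ_{s ⊆ E : K s ∩ X = ∅, K(E∖s) ∩ X = ∅} T(K s, K(E∖s))`  (the event is a union of fibres);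
  with `X = {y}` this is the atom `A₀₀ ≥ 0` of NC-SPLIT, with `X = ∅` the off-cluster sum.
CONJECTURE M-FIBRE (prim-lf-2 gen 61): for the clusters of a root `x` in a finite multigraph under the uniform two-colouring, every `K ∪ B`-fibre is twisted
positively associated (exact census: every connected graph on ≤ 5 vertices and every `M`: 0 failures; multigraphs on 4 vertices; it fails at `p ≠ 1/2` and
for the finer `(K∪B, K∩B)`-fibres).  [cite: KozmaNitzan2024, Questions 8–9 (§5.5 p. 36) (context: the Question-8 pocket covariance programme)]
-/

namespace Summit.CriticalPhenomena.PercolationContinuityZ3.Theorems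

open Finset

namespace Coefficientwise

variable {ι V : Type*}

open Classical in
/-- **T-sum on a flip-symmetric, twisted positively associated block.**  Let `F` be a finset of red sets with `s ∈ F → E ∖ s ∈ F` and `s ∈ F → s ⊆ E`,
on which the uniform measure is positively associated for the twisted preorder of `(K s, K(E∖s))`: for all `Φ Ψ` monotone in that preorder on `F`,
`(Σ_F Φ)(Σ_F Ψ) ≤ |F| Σ_F ΦΨ`.  Then `0 ≤ Σ_{s∈F} (f(K s) − f(K(E∖s)))(g(K s) − g(K(E∖s)))` for monotone `f, g`. [folklore] -/
theorem flipBlock_tsum_nonneg [DecidableEq ι] (E : Finset ι) (K : Finset ι → Set V) (F : Finset (Finset ι)) (f g : Set V → ℝ)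
    (hf : Monotone f) (hg : Monotone g)
    (hFE : ∀ s ∈ F, s ⊆ E) (hflip : ∀ s ∈ F, E \ s ∈ F)
    (hPA : ∀ Φ Ψ : Finset ι → ℝ,
      (∀ s ∈ F, ∀ t ∈ F, K s ⊆ K t → K (E \ t) ⊆ K (E \ s) → Φ s ≤ Φ t) →
      (∀ s ∈ F, ∀ t ∈ F, K s ⊆ K t → K (E \ t) ⊆ K (E \ s) → Ψ s ≤ Ψ t) →
      (∑ s ∈ F, Φ s) * (∑ s ∈ F, Ψ s) ≤ (F.card : ℝ) * ∑ s ∈ F, Φ s * Ψ s) :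
    0 ≤ ∑ s ∈ F, (f (K s) - f (K (E \ s))) * (g (K s) - g (K (E \ s))) := by
  -- the four twisted-monotone functions
  set fK : Finset ι → ℝ := fun s => f (K s) with hfK
  set gK : Finset ι → ℝ := fun s => g (K s) with hgK
  set fB : Finset ι → ℝ := fun s => - f (K (E \ s)) with hfB
  set gB : Finset ι → ℝ := fun s => - g (K (E \ s)) with hgB
  have mfK : ∀ s ∈ F, ∀ t ∈ F, K s ⊆ K t → K (E \ t) ⊆ K (E \ s) → fK s ≤ fK t := fun s _ t _ h1 _ => hf h1
  have mgK : ∀ s ∈ F, ∀ t ∈ F, K s ⊆ K t → K (E \ t) ⊆ K (E \ s) → gK s ≤ gK t := fun s _ t _ h1 _ => hg h1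
  have mfB : ∀ s ∈ F, ∀ t ∈ F, K s ⊆ K t → K (E \ t) ⊆ K (E \ s) → fB s ≤ fB t :=
    fun s _ t _ _ h2 => by simp only [hfB]; exact neg_le_neg (hf h2)
  have mgB : ∀ s ∈ F, ∀ t ∈ F, K s ⊆ K t → K (E \ t) ⊆ K (E \ s) → gB s ≤ gB t :=
    fun s _ t _ _ h2 => by simp only [hgB]; exact neg_le_neg (hg h2)
  have h1 := hPA fK gK mfK mgK
  have h2 := hPA fB gB mfB mgB
  have h3 := hPA fK gB mfK mgB
  have h4 := hPA fB gK mfB mgK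
  -- flip invariance of the one-point sums
  have hss : ∀ s ∈ F, E \ (E \ s) = s := fun s hs => Finset.sdiff_sdiff_eq_self (hFE s hs)
  have flip_sum : ∀ h : Set V → ℝ, ∑ s ∈ F, h (K (E \ s)) = ∑ s ∈ F, h (K s) := by
    intro h
    refine Finset.sum_bij' (fun s _ => E \ s) (fun s _ => E \ s) ?_ ?_ ?_ ?_ ?_
    · intro s hs; exact hflip s hs
    · intro s hs; exact hflip s hs
    · intro s hs; exact hss s hs
    · intro s hs; exact hss s hs
    · intro s hs; rfl
  have eF : ∑ s ∈ F, fB s = - ∑ s ∈ F, fK s := by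
    simp only [hfB, hfK, Finset.sum_neg_distrib, flip_sum f]
  have eG : ∑ s ∈ F, gB s = - ∑ s ∈ F, gK s := by
    simp only [hgB, hgK, Finset.sum_neg_distrib, flip_sum g]
  -- expand the T-sum into the four products
  have expand : ∑ s ∈ F, (f (K s) - f (K (E \ s))) * (g (K s) - g (K (E \ s))) =
      ∑ s ∈ F, fK s * gK s + ∑ s ∈ F, fB s * gB s + ∑ s ∈ F, fK s * gB s + ∑ s ∈ F, fB s * gK s := by
    rw [← Finset.sum_add_distrib, ← Finset.sum_add_distrib, ← Finset.sum_add_distrib]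
    refine Finset.sum_congr rfl fun s _ => ?_
    simp only [hfK, hgK, hfB, hgB]; ring
  rw [expand]
  by_cases hF0 : F.card = 0
  · rw [Finset.card_eq_zero.mp hF0]; simp
  have hcard : (0 : ℝ) < F.card := by exact_mod_cast Nat.pos_of_ne_zero hF0
  -- `|F| · (sum of the four) ≥ (ΣfK + ΣfB)(ΣgK + ΣgB) = 0`
  have key : (F.card : ℝ) * (∑ s ∈ F, fK s * gK s + ∑ s ∈ F, fB s * gB s + ∑ s ∈ F, fK s * gB s + ∑ s ∈ F, fB s * gK s) ≥
      (∑ s ∈ F, fK s + ∑ s ∈ F, fB s) * (∑ s ∈ F, gK s + ∑ s ∈ F, gB s) := by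
    nlinarith [h1, h2, h3, h4]
  have zero : (∑ s ∈ F, fK s + ∑ s ∈ F, fB s) * (∑ s ∈ F, gK s + ∑ s ∈ F, gB s) = 0 := by
    rw [eF, eG]; ring
  rw [zero] at key
  exact le_of_mul_le_mul_left (by simpa using key) hcard

open Classical in
/-- **Two-sided avoidance sums from fibre positive association.**  If every fibre `{s ⊆ E : K s ∪ K(E∖s) = M}` of `M = K ∪ B` is twisted positively
associated (hypothesis `hPA`, uniform measure on the fibre), then for every vertex set `X`:
`0 ≤ Σ_{s ⊆ E : K s ∩ X = ∅ ∧ K(E∖s) ∩ X = ∅} (f(K s) − f(K(E∖s)))(g(K s) − g(K(E∖s)))` for monotone `f, g`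
(the event `{(K ∪ B) ∩ X = ∅}` is a union of fibres, each flip-invariant).  `X = {y}`: the atom `A₀₀`; `X = ∅`: the off-cluster sum. [folklore] -/
theorem twoSidedAvoidance_tsum_nonneg_of_fibrePA [DecidableEq ι] (E : Finset ι) (K : Finset ι → Set V) (X : Set V) (f g : Set V → ℝ)
    (hf : Monotone f) (hg : Monotone g)
    (hPA : ∀ M : Set V, ∀ Φ Ψ : Finset ι → ℝ,
      (∀ s ∈ E.powerset.filter (fun s => K s ∪ K (E \ s) = M), ∀ t ∈ E.powerset.filter (fun s => K s ∪ K (E \ s) = M),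
          K s ⊆ K t → K (E \ t) ⊆ K (E \ s) → Φ s ≤ Φ t) →
      (∀ s ∈ E.powerset.filter (fun s => K s ∪ K (E \ s) = M), ∀ t ∈ E.powerset.filter (fun s => K s ∪ K (E \ s) = M),
          K s ⊆ K t → K (E \ t) ⊆ K (E \ s) → Ψ s ≤ Ψ t) →
      (∑ s ∈ E.powerset.filter (fun s => K s ∪ K (E \ s) = M), Φ s) * (∑ s ∈ E.powerset.filter (fun s => K s ∪ K (E \ s) = M), Ψ s) ≤
        ((E.powerset.filter (fun s => K s ∪ K (E \ s) = M)).card : ℝ) * ∑ s ∈ E.powerset.filter (fun s => K s ∪ K (E \ s) = M), Φ s * Ψ s) :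
    0 ≤ ∑ s ∈ E.powerset.filter (fun s => (∀ x ∈ X, x ∉ K s) ∧ (∀ x ∈ X, x ∉ K (E \ s))),
      (f (K s) - f (K (E \ s))) * (g (K s) - g (K (E \ s))) := by
  set Tf : Finset ι → ℝ := fun s => (f (K s) - f (K (E \ s))) * (g (K s) - g (K (E \ s))) with hTf
  set D : Finset (Finset ι) := E.powerset.filter (fun s => (∀ x ∈ X, x ∉ K s) ∧ (∀ x ∈ X, x ∉ K (E \ s))) with hD
  change 0 ≤ ∑ s ∈ D, Tf s
  -- split `D` along the fibres of `M(s) = K s ∪ K (E ∖ s)`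
  set Mof : Finset ι → Set V := fun s => K s ∪ K (E \ s) with hMof
  rw [← Finset.sum_fiberwise_of_maps_to (s := D) (t := D.image Mof) (g := Mof) (fun s hs => Finset.mem_image_of_mem Mof hs)]
  refine Finset.sum_nonneg fun M hM => ?_
  obtain ⟨s₀, hs₀D, rfl⟩ := Finset.mem_image.mp hM
  -- the fibre of `Mof s₀` inside `D` is the whole fibre inside `𝒫(E)` (the event depends on `M` only)
  have hMX : ∀ x ∈ X, x ∉ Mof s₀ := by
    intro x hx hxM
    have h := (Finset.mem_filter.mp hs₀D).2
    rcases hxM with h1 | h1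
    · exact h.1 x hx h1
    · exact h.2 x hx h1
  have fib_eq : D.filter (fun s => Mof s = Mof s₀) = E.powerset.filter (fun s => K s ∪ K (E \ s) = Mof s₀) := by
    ext s
    simp only [hD, Finset.mem_filter, Finset.mem_powerset]
    constructor
    · rintro ⟨⟨hsE, _⟩, hM⟩; exact ⟨hsE, hM⟩
    · rintro ⟨hsE, hM⟩
      refine ⟨⟨hsE, ?_, ?_⟩, hM⟩
      · intro x hx hxK; exact hMX x hx (hM ▸ Or.inl hxK)
      · intro x hx hxK; exact hMX x hx (hM ▸ Or.inr hxK)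
  rw [fib_eq]
  set F : Finset (Finset ι) := E.powerset.filter (fun s => K s ∪ K (E \ s) = Mof s₀) with hF
  have hFE : ∀ s ∈ F, s ⊆ E := fun s hs => Finset.mem_powerset.mp (Finset.mem_filter.mp hs).1
  have hflip : ∀ s ∈ F, E \ s ∈ F := by
    intro s hs
    obtain ⟨hsE, hM⟩ := Finset.mem_filter.mp hs
    refine Finset.mem_filter.mpr ⟨Finset.mem_powerset.mpr Finset.sdiff_subset, ?_⟩
    rw [Finset.sdiff_sdiff_eq_self (Finset.mem_powerset.mp hsE), Set.union_comm]; exact hM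
  exact flipBlock_tsum_nonneg E K F f g hf hg hFE hflip (hPA (Mof s₀))

end Coefficientwise

end Summit.CriticalPhenomena.PercolationContinuityZ3.Theorems
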